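/-
Copyright (c) 2026 the pub-hodgecm-mathlib formalisation cell (harness21).  Prover seat hodgecm-mathlib-K2Liu-p01 (g10), Track B «K2-LIT»,
#184♮ = hLiu418 = `stmt-HodgeConjecture-24832`; #42S organ S1 ROAD W, hole (iv) «`S_δ`» of the named input S1-exc (LEAD F0P6-plan (g14) σ22 (D1); K2Liu-p01 (g10)
census 2026-09-04T16:0xZ), file (δ1): ★ (B5) `K2LiuLocalSWDualBoxIndex` WITHOUT THE LETTER `hδu` — the index `[𝔰 ∩ Λ_m : 𝔰 ∩ Λ_0] = q_v^{4m}` of the dual boxes at an inert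
unramified place for ANY purely imaginary `δ ≠ 0` (no condition `|δ̂|_w = 1`).
-/
import Summits.HodgeConjecture.HodgeConjecture.Theorems.K2LiuLocalSWDualBoxIndex     -- ★ (B5) `relIndex_inf_box_eq_pow`, `card_quotient_inf_box_eq_pow` (with `hδu`)
import HarnessLib

/-!
# Crux `HLiu418`, #42S-S1 ROAD W, hole (iv) «`S_δ`», file (δ1): THE INDEX `q_v^{4m}` OF THE DUAL BOXES WITHOUT `hδu`

Cell `hodgecm-mathlib`, crux item hLiu418 = `stmt-HodgeConjecture-24832` (helper lane `--supports … --as helper`, count-neutral).  THEOREMS ONLY (no `def`, no instance,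
no notation, no named-fact hypothesis, no `sorry`).  Currency of ★ (B5): quadratic `E/F` with `c`, purely imaginary `δ ≠ 0` (`hcδ hδ`), finite place `v` with uniformiser `π`
(`hπ`), `T₀` symmetric invertible, the skew subgroup `𝔰 = S` (`hS`), an inert place `w₀` (`hw₀`) at which `ι_{w₀}π` is a uniformiser (`hπw`), the dual boxes `Λ_j` BY VALUE through
their carriers `{t | ∀ i i′ w, |(δ̂·(𝕋₀t))_{ii′}|_w ≤ |ι_wπ|_w^{c₀ − j − [i=i′]e₂}}` (★ (B) `exists_addSubgroup_box`).

WHY.  ★ (B5) (and through it ★ (W2-d) `sum_profile_eq_shape_inert`, ★ (W2-f), ★ (W2-g) `finite_quotient_inf_box`, ★ (H4)∕★ FILE B `K2LiuLocalSWSpanningInertDyadic`) carries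
`hδu : ∀ w, |δ̂|_w = 1` — false at the finitely many inert places `v ∈ S_δ` where the global purely imaginary `δ` (for the K2Lit chain, `δ = imagUnit L`) is not a `w`-unit: this is
sub-face (iv) of the named input S1-exc.  But the index is SHIFT-INVARIANT and the box family sees `δ` only through `|δ̂|_{w₀}`: with `|δ̂|_{w₀} = P^e` (`P = |ι_{w₀}π|`, `e ∈ ℤ` by
discreteness) and a GLOBAL uniformiser `π_F ∈ F` at `v` (Mathlib `valuation_exists_uniformizer`), the element `δ′ := π_F^{−e}·δ ∈ E` is purely imaginary, non-zero, a
`w₀`-unit, and **`BOX_j(δ, c₀) = BOX_j(δ′, c₀ − e)`** — so ★ (B5) at `(δ′, c₀ − e)` computes the index of the SAME family `Λ`.  Hence: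
* `exists_unit_rescale`: `∃ δ′ e, c δ′ = −δ′ ∧ δ′ ≠ 0 ∧ (∀ w, |δ̂′|_w = 1) ∧ ∀ j, BOX_j(δ, c₀) = BOX_j(δ′, c₀ − e)`;
* **`relIndex_inf_box_eq_pow_of_ne_zero`**, **`card_quotient_inf_box_eq_pow_of_ne_zero`** = ★ (B5)'s two heads with the binder `hδu` DELETED (conclusions byte-identical);
* §3 (ED. 2) `finite_quotient_inf_box_of_ne_zero` = ★ (W2-g) `finite_quotient_inf_box` with `hδu` DELETED (the consumer's `Fintype` instance at every inert unramified place).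
Downstream (files (δ2)–(δ5) of this hand): `hδu` disappears from ★ (W2-g)'s `Fintype`, ★ (W2-d), ★ (W2-f) and ★ FILE B; `vd = ord_v(δ²)` stays free in `hdn`∕`hc₀`, so the places
`v ∈ S_δ` are served by the generic inert rows with `c₀ = m_ψ + vd`.  [Shimura1997, §13.2] [BushnellHenniart2006, §1.1] [CasselsFrohlichANT1967, Ch. II §10].
HONEST LABEL.  Count-neutral helper; `HC_CM` is proved only modulo the 7 printed citations (2 remaining named inputs: hLiu418 = `stmt-HodgeConjecture-24832`,
h413 = `stmt-HodgeConjecture-24833`) until rung 0 closes.  NOT here: (δ2)–(δ5), the consumer switch (K2E4-p10 (ℓ2)).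

## References
* [Shimura1997] G. Shimura, *Euler Products and Eisenstein Series*, CBMS 93 (1997), §13.2.
* [BushnellHenniart2006] C. Bushnell, G. Henniart, *The Local Langlands Conjecture for GL(2)* (2006), §1.1.
* [CasselsFrohlichANT1967] Cassels–Fröhlich, *Algebraic Number Theory* (1967), Ch. II §10.
-/

set_option autoImplicit false
set_option linter.dupNamespace false -- the mandated namespace repeats `HodgeConjecture.HodgeConjecture`

noncomputable section

open scoped Matrix
open NumberField IsDedekindDomain Matrix
open Literature.NumberTheory.Automorphic Literature.NumberTheory.Automorphic.UnitaryGroup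
open Literature.NumberTheory.GelbartRogawski1991.UnitaryDualPair Literature.NumberTheory.GelbartRogawski1991.UnitaryDualPair.LocalSplitting

namespace Summit.HodgeConjecture.HodgeConjecture.Cruxes.HLiu418.K2LiuLocalSWDualBoxIndexOfNeZero

open K2LiuLocalRingValuationBalls K2LiuLocalSWDualBoxIndex

variable (F : Type) [Field F] [NumberField F] (E : Type) [Field E] [NumberField E] [Algebra F E] [Algebra.IsQuadraticExtension F E]
  (c : E ≃ₐ[F] E) {δ : E} (hcδ : c δ = -δ) (hδ : δ ≠ 0)
  (v : HeightOneSpectrum (𝓞 F)) {π : v.adicCompletion F} (hπ : Valued.v π = WithZero.exp (-1 : ℤ))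
  {T₀ : Matrix (Fin 2) (Fin 2) F} (hT₀ : T₀.IsSymm) (hT₀d : IsUnit T₀.det)
  (S : AddSubgroup (Matrix (Fin 2) (Fin 2) (LocalRing E v)))
  (hS : ∀ t, t ∈ S ↔ (t.map (conjLocal E c v))ᵀ * gramS F E v 2 T₀ + gramS F E v 2 T₀ * t = 0)

/-! ## §1 The unit rescaling `δ′ = π_F^{−e}·δ` -/

omit [NumberField F] [Algebra.IsQuadraticExtension F E] in
include hcδ hδ in
/-- `c ≠ 1` (it negates the non-zero `δ`; characteristic `0`). [folklore] -/
theorem ne_one_of_apply_eq_neg : c ≠ 1 := by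
  rintro rfl
  rw [AlgEquiv.one_apply] at hcδ
  have h2 : (2 : E) * δ = 0 := by linear_combination hcδ
  exact hδ ((mul_eq_zero.mp h2).resolve_left two_ne_zero)

omit [Algebra.IsQuadraticExtension F E] in
include hπ in
/-- **`ι_{w₀}` IS VALUATION-PRESERVING when `ι_{w₀}π` is a uniformiser**: `|ι_{w₀} y|_{w₀} = |y|_v` (`|ι_w y| = |y|^{e(w|v)}` ★ `valued_toPlace`, and `exp(−1)^{e} = exp(−1)` forces the
exponent). [cite: CasselsFrohlichANT1967, Ch. II §10] -/
theorem valued_toPlace_eq_of_uniformizer (w₀ : PlacesOver E v) (hπw : Valued.v (toPlace v w₀ π) = WithZero.exp (-1 : ℤ)) (y : v.adicCompletion F) :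
    Valued.v (toPlace v w₀ y) = Valued.v y := by
  have he : Valued.v π ^ v.asIdeal.ramificationIdx' w₀.1.asIdeal = Valued.v π := by rw [← valued_toPlace, hπw, hπ]
  by_cases hy : y = 0
  · simp [hy]
  obtain ⟨n, hn⟩ : ∃ n : ℤ, Valued.v y = Valued.v π ^ n :=
    ⟨-WithZero.log (Valued.v y), by rw [hπ, ← WithZero.exp_zsmul, smul_eq_mul, mul_neg, mul_one, neg_neg, WithZero.exp_log ((Valuation.ne_zero_iff _).2 hy)]⟩
  rw [valued_toPlace, hn, ← zpow_natCast, ← _root_.zpow_mul, mul_comm n, _root_.zpow_mul, zpow_natCast, he]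

include hcδ hδ hπ in
/-- **THE UNIT RESCALING**: at an inert place where `ι_{w₀}π` is a uniformiser there are `δ′ ∈ E` purely imaginary non-zero with `|δ̂′|_w = 1` for all `w ∣ v` and `e ∈ ℤ` with
`BOX_j(δ, c₀) = BOX_j(δ′, c₀ − e)` for every `j` (`δ′ = π_F^{−e}·δ`, `π_F ∈ F` a global uniformiser at `v`, `|δ̂|_{w₀} = P^e`). [cite: CasselsFrohlichANT1967, Ch. II §10] -/
theorem exists_unit_rescale (w₀ : PlacesOver E v) (hw₀ : c • w₀.1 = w₀.1) (hπw : Valued.v (toPlace v w₀ π) = WithZero.exp (-1 : ℤ)) (c₀ e₂ : ℤ) :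
    ∃ (δ' : E) (e : ℤ), c δ' = -δ' ∧ δ' ≠ 0 ∧ (∀ w : PlacesOver E v, Valued.v (algebraMap E (LocalRing E v) δ' w) = 1) ∧
      ∀ j : ℤ, {t : Matrix (Fin 2) (Fin 2) (LocalRing E v) | ∀ i i' (w : PlacesOver E v),
          Valued.v ((algebraMap E (LocalRing E v) δ • (gramS F E v 2 T₀ * t)) i i' w) ≤ Valued.v (toPlace v w π) ^ (c₀ - j - if i = i' then e₂ else 0)} =
        {t : Matrix (Fin 2) (Fin 2) (LocalRing E v) | ∀ i i' (w : PlacesOver E v),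
          Valued.v ((algebraMap E (LocalRing E v) δ' • (gramS F E v 2 T₀ * t)) i i' w) ≤ Valued.v (toPlace v w π) ^ ((c₀ - e) - j - if i = i' then e₂ else 0)} := by
  haveI : Subsingleton (PlacesOver E v) := PlacesOver.subsingleton_of_smul_eq c (ne_one_of_apply_eq_neg F E c hcδ hδ) w₀ hw₀
  have hP : Valued.v (toPlace v w₀ π) ≠ 0 := valued_toPlace_uniformizer_ne_zero F E v hπ w₀
  -- `|δ̂|_{w₀} = P^e`
  have hδw : algebraMap E (LocalRing E v) δ w₀ ≠ 0 := fun h => hδ (by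
    rw [Pi.algebraMap_apply] at h
    exact (map_eq_zero_iff _ (algebraMap E (w₀.1.adicCompletion E)).injective).1 h)
  obtain ⟨e, he⟩ : ∃ e : ℤ, Valued.v (algebraMap E (LocalRing E v) δ w₀) = Valued.v (toPlace v w₀ π) ^ e :=
    ⟨-WithZero.log (Valued.v (algebraMap E (LocalRing E v) δ w₀)), by
      rw [hπw, ← WithZero.exp_zsmul, smul_eq_mul, mul_neg, mul_one, neg_neg, WithZero.exp_log ((Valuation.ne_zero_iff _).2 hδw)]⟩
  -- a global uniformiser `π_F` at `v`; `|ι_{w₀} π_F| = P`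
  obtain ⟨πF, hπF⟩ := v.valuation_exists_uniformizer F
  have hπF0 : (πF : F) ≠ 0 := by
    intro h
    rw [h, map_zero] at hπF
    exact WithZero.zero_ne_coe hπF
  -- `δ′ = π_F^{−e}·δ` is a `w`-unit
  have hunit : ∀ w : PlacesOver E v, Valued.v (algebraMap E (LocalRing E v) (algebraMap F E (πF ^ (-e)) * δ) w) = 1 := by
    intro w
    obtain rfl : w = w₀ := Subsingleton.elim w w₀
    rw [map_mul, Pi.mul_apply, map_mul, ← toLocalRing_coe, toLocalRing_apply, valued_toPlace_eq_of_uniformizer F E v hπ w hπw,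
      HeightOneSpectrum.valuedAdicCompletion_eq_valuation', map_zpow₀, hπF, he, hπw, ← zpow_add₀ WithZero.coe_ne_zero, neg_add_cancel, zpow_zero]
  refine ⟨algebraMap F E (πF ^ (-e)) * δ, e, ?_, ?_, hunit, fun j => Set.ext fun t => ?_⟩
  · rw [map_mul, AlgEquiv.commutes, hcδ, mul_neg]
  · exact mul_ne_zero ((map_ne_zero_iff _ (algebraMap F E).injective).2 (zpow_ne_zero _ hπF0)) hδ
  · simp only [Set.mem_setOf_eq]
    refine forall_congr' fun i => forall_congr' fun i' => forall_congr' fun w => ?_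
    obtain rfl : w = w₀ := Subsingleton.elim w w₀
    have hX : ∀ u : E, (algebraMap E (LocalRing E v) u • (gramS F E v 2 T₀ * t)) i i' w = algebraMap E (LocalRing E v) u w * (gramS F E v 2 T₀ * t) i i' w :=
      fun u => by rw [Matrix.smul_apply, smul_eq_mul, Pi.mul_apply]
    rw [hX, hX, map_mul, map_mul, he, hunit w, one_mul, show c₀ - e - j - (if i = i' then e₂ else 0) = (c₀ - j - if i = i' then e₂ else 0) - e by ring,
      zpow_sub₀ hP (c₀ - j - if i = i' then e₂ else 0) e, le_div_iff₀ (zpow_pos (zero_lt_iff.2 hP) e), mul_comm]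

/-! ## §2 ★ (B5) without `hδu` -/

include hcδ hδ hπ hT₀ hT₀d hS in
/-- **`[𝔰 ∩ Λ_m : 𝔰 ∩ Λ_0] = q_v^{4m}` WITHOUT `hδu`** (★ (B5) `relIndex_inf_box_eq_pow` at the unit rescaling `(δ′, c₀ − e)` of §1 — the same family `Λ`).
[cite: Shimura1997, §13.2] [cite: BushnellHenniart2006, §1.1] -/
theorem relIndex_inf_box_eq_pow_of_ne_zero (w₀ : PlacesOver E v) (hw₀ : c • w₀.1 = w₀.1) (hπw : Valued.v (toPlace v w₀ π) = WithZero.exp (-1 : ℤ)) (c₀ e₂ : ℤ)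
    (Λ : ℤ → AddSubgroup (Matrix (Fin 2) (Fin 2) (LocalRing E v)))
    (hΛ : ∀ j : ℤ, (Λ j : Set (Matrix (Fin 2) (Fin 2) (LocalRing E v))) = {t | ∀ i i' (w : PlacesOver E v),
      Valued.v ((algebraMap E (LocalRing E v) δ • (gramS F E v 2 T₀ * t)) i i' w) ≤ Valued.v (toPlace v w π) ^ (c₀ - j - if i = i' then e₂ else 0)})
    (m : ℕ) : (S ⊓ Λ 0).relIndex (S ⊓ Λ m) = v.residueCard ^ (4 * m) := by
  obtain ⟨δ', e, hcδ', hδ', hδu', hbox⟩ := exists_unit_rescale F E c hcδ hδ v hπ w₀ hw₀ hπw c₀ e₂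
  exact relIndex_inf_box_eq_pow F E c hcδ' hδ' v hπ hT₀ hT₀d S hS w₀ hw₀ hπw hδu' (c₀ - e) e₂ Λ (fun j => (hΛ j).trans (hbox j)) m

include hcδ hδ hπ hT₀ hT₀d hS in
/-- **THE `hcard` LETTER WITHOUT `hδu`**: `Fintype.card (𝔰 ∩ Λ_m ⧸ 𝔰 ∩ Λ_0) = q_v^{4m}` (★ (B5) `card_quotient_inf_box_eq_pow` at the unit rescaling of §1).
[cite: Shimura1997, §13.2] [cite: BushnellHenniart2006, §1.1] -/
theorem card_quotient_inf_box_eq_pow_of_ne_zero (w₀ : PlacesOver E v) (hw₀ : c • w₀.1 = w₀.1) (hπw : Valued.v (toPlace v w₀ π) = WithZero.exp (-1 : ℤ)) (c₀ e₂ : ℤ)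
    (Λ : ℤ → AddSubgroup (Matrix (Fin 2) (Fin 2) (LocalRing E v)))
    (hΛ : ∀ j : ℤ, (Λ j : Set (Matrix (Fin 2) (Fin 2) (LocalRing E v))) = {t | ∀ i i' (w : PlacesOver E v),
      Valued.v ((algebraMap E (LocalRing E v) δ • (gramS F E v 2 T₀ * t)) i i' w) ≤ Valued.v (toPlace v w π) ^ (c₀ - j - if i = i' then e₂ else 0)})
    (m : ℕ) [Fintype (↥(S ⊓ Λ m) ⧸ (S ⊓ Λ 0).addSubgroupOf (S ⊓ Λ m))] :
    Fintype.card (↥(S ⊓ Λ m) ⧸ (S ⊓ Λ 0).addSubgroupOf (S ⊓ Λ m)) = v.residueCard ^ (4 * m) := by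
  obtain ⟨δ', e, hcδ', hδ', hδu', hbox⟩ := exists_unit_rescale F E c hcδ hδ v hπ w₀ hw₀ hπw c₀ e₂
  exact card_quotient_inf_box_eq_pow F E c hcδ' hδ' v hπ hT₀ hT₀d S hS w₀ hw₀ hπw hδu' (c₀ - e) e₂ Λ (fun j => (hΛ j).trans (hbox j)) m

/-! ## §3 (ED. 2) The consumer's `Fintype` without `hδu` — ★ (W2-g) `finite_quotient_inf_box` minus its unit letter -/

include hcδ hδ hπ hT₀ hT₀d hS in
/-- **`(S ⊓ Λ_m)⧸(S ⊓ Λ₀)` IS FINITE WITHOUT `hδu`** (index `q^{4m}` by §2 `relIndex_inf_box_eq_pow_of_ne_zero`) — the `Fintype` binders of ★ (T4-core)∕(W2-f)∕★ FILE B by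
`Fintype.ofFinite`, at EVERY inert unramified place (the places `v ∈ S_δ` included). [cite: Shimura1997, §13.2] [cite: BushnellHenniart2006, §1.1] -/
theorem finite_quotient_inf_box_of_ne_zero (w₀ : PlacesOver E v) (hw₀ : c • w₀.1 = w₀.1) (hπw : Valued.v (toPlace v w₀ π) = WithZero.exp (-1 : ℤ)) (c₀ e₂ : ℤ)
    (Λ : ℤ → AddSubgroup (Matrix (Fin 2) (Fin 2) (LocalRing E v)))
    (hΛ : ∀ j : ℤ, (Λ j : Set (Matrix (Fin 2) (Fin 2) (LocalRing E v))) = {t | ∀ i i' (w : PlacesOver E v),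
      Valued.v ((algebraMap E (LocalRing E v) δ • (gramS F E v 2 T₀ * t)) i i' w) ≤ Valued.v (toPlace v w π) ^ (c₀ - j - if i = i' then e₂ else 0)})
    (m : ℕ) : Finite (↥(S ⊓ Λ (m : ℤ)) ⧸ (S ⊓ Λ 0).addSubgroupOf (S ⊓ Λ (m : ℤ))) := by
  have h := relIndex_inf_box_eq_pow_of_ne_zero F E c hcδ hδ v hπ hT₀ hT₀d S hS w₀ hw₀ hπw c₀ e₂ Λ hΛ m
  have hne : ((S ⊓ Λ 0).addSubgroupOf (S ⊓ Λ (m : ℤ))).index ≠ 0 := by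
    rw [← AddSubgroup.relIndex, h]
    have hq : (1 : ℝ) < (v.residueCard : ℝ) := K2LiuGoodPlaceWhittakerUnimodularValueCM.one_lt_residueCard F v
    exact pow_ne_zero _ (by exact_mod_cast (one_pos.trans hq).ne')
  haveI := AddSubgroup.fintypeOfIndexNeZero hne
  exact Finite.of_fintype _

end Summit.HodgeConjecture.HodgeConjecture.Cruxes.HLiu418.K2LiuLocalSWDualBoxIndexOfNeZero

end
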